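import Summits.MatrixMultiplication.OmegaCensus.STPPRoleSymmetry
import Mathlib.GroupTheory.Index

/-!
# STPP families lift FAT along surjections: one role may take full preimages

Cell `pub-omega`, ω construction census, seat pub-omega ENG2 (gen 31). HONEST FRAMING (verbatim): lottery ticket; floor =
certified bounds/negative ranges.  Census STRUCTURE bookkeeping (question Q7 / column B5: onsets of the size patterns
`(1,1,1)^k` (tricolored sum-free sets), `(2,1,1)^k` (`T1`), `(1,2,2)^k` (`T2`), `(2,2,2)^k` (`n_k`)); nothing here bears on `ω`.

The tree already has two transport rules for CKSU Def. 5.1 (tree `IsSTPP`): along INJECTIVE additive maps (`isSTPP_image`) and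
along SECTIONS of surjective ones with the SAME cardinalities (`IsSTPP.image_section`, `exists_isSTPP_of_surjective`, file
`STPPQuotientLift.lean`).  This file records the stronger **fat lift**: along a surjective additive hom `q : G → Q`, an STPP
family `(Aᵢ, Bᵢ, Cᵢ)` of `Q` lifts to the family `(q⁻¹(Aᵢ), s(Bᵢ), s(Cᵢ))` of `G` — the `A`-sets replaced by their FULL
PREIMAGES, the other two roles by any section `s` — and this is again an STPP family (`IsSTPP.preimage_section`).  Proof: apply
`q` to the defining word; the quotient family forces `i = j = k`, `q s = q s'`, `t = t'`, `u = u'` (the last two because `s` is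
injective on `Q`), and then the word itself gives `s' − s = 0`.  Cardinalities: `|q⁻¹(Aᵢ)| = |Aᵢ| · |q⁻¹(0)|`
(`card_filter_map_mem`, all fibres of a surjective hom have the size of the zero fibre, Mathlib
`AddMonoidHom.card_fiber_eq_of_mem_range`).  By the kernel role symmetry (`STPPRoleSymmetry.lean`) any ONE of the three roles
may be the fat one (`exists_isSTPP_fatA/fatB/fatC_of_surjective`).

This is the block-product law `IsSTPP.prod` with a one-point second factor in the thin roles, but for ARBITRARY (non-split)
extensions `0 → N → G → Q → 0`; e.g. `ℤ/4 × ℤ/8 → ℤ/2 × ℤ/8` or `ℤ/2 × ℤ/16 → ℤ/2 × ℤ/8`, where `G` is not `N × Q`.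

CENSUS CONSEQUENCES (size patterns, kernel of order `m`; stated below for the census patterns with `m = 2`):
* `(1,1,1)^k ⊆ Q ⇒ (2,1,1)^k ⊆ G` (`exists_isSTPP_211_of_111_of_surjective`): `T1(G) ≥ TSF(G/N)` for every subgroup `N` of
  order 2 — e.g. the size-6 tricolored sum-free sets of the four non-cyclic groups of order 16 give `(2,1,1)⁶` in every
  non-cyclic abelian group of order 32 (tree witnesses `exists_isSTPP_211pow6_*`, whose `A`-differences are indeed constant);
* `(2,1,1)^k ⊆ Q ⇒ (1,2,2)^k ⊆ G` (`exists_isSTPP_122_of_211_of_surjective`, fatten `C`, then rotate the roles):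
  `T2(G) ≥ T1(G/N)` — e.g. `(2,1,1)⁴ ⊆ ℤ/2 × ℤ/8` (tree, `exists_isSTPP_211pow4_zmod2_zmod8`) gives `(1,2,2)⁴` in
  `ℤ/2 × ℤ/16`, `ℤ/4 × ℤ/8`, `ℤ/2 × ℤ/2 × ℤ/8` (order 32; explicit kernel witnesses in `STPPSmallPatternT2K4Order32.lean`);
* `(1,2,2)^k ⊆ Q ⇒ (2,2,2)^k ⊆ G` (`exists_isSTPP_222_of_122_of_surjective`): `n_k ≤ 2 · onset(T2, k)`, and every
  order-`2|H|` extension of a `T2`-host `H` hosts `(2,2,2)^k` (e.g. `(1,2,2)⁶ ⊆ (ℤ/4)³` gives `(2,2,2)⁶ ⊆ ℤ/4 × ℤ/4 × ℤ/8`).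
Chained: `n_k ≤ 2·onset_T2(k) ≤ 4·onset_T1(k) ≤ 8·onset_TSF(k)`; the census rows `onset_T1 = 6/12/16/24`, `onset_T2 = 12/24`
(kernel, `STPPSmallPatternT1Below24`, `…T2Below24`) and `n₂ = 24` sit exactly on this chain for `k = 2, 3`.

References: H. Cohn, R. Kleinberg, B. Szegedy, C. Umans, *Group-theoretic algorithms for matrix multiplication*, FOCS 2005
(arXiv:math/0511460), Def. 5.1 and §7 (families in direct products).  Seat pub-omega ENG2 (gen 31), 2026-08-28.
-/

open Literature.Computability.AlgebraicComplexity Finset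

namespace Summit.MatrixMultiplication.OmegaCensus

variable {G Q : Type*} [AddCommGroup G] [AddCommGroup Q] {N : ℕ}

/-- **Fat lift of an STPP family along a surjection.** Let `q : G →+ Q` be an additive hom with a set-theoretic section `s`
(`q (s x) = x`).  If `(Aᵢ, Bᵢ, Cᵢ)` is an STPP family in `Q` (CKSU Def. 5.1), then so is the family of `G` whose `A`-sets are
the FULL PREIMAGES `{g | q g ∈ Aᵢ}` and whose `B`-, `C`-sets are the section images `s(Bᵢ)`, `s(Cᵢ)`.  (Apply `q` to the
defining word: the quotient family gives `i = j = k`, `t = t'`, `u = u'`; then the word reads `s' − s = 0`.)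
[cite: CohnKleinbergSzegedyUmans2005, Def. 5.1] -/
theorem _root_.Literature.Computability.AlgebraicComplexity.IsSTPP.preimage_section [Fintype G] [DecidableEq G]
    [DecidableEq Q] (q : G →+ Q) (s : Q → G) (hs : ∀ x, q (s x) = x) {A B C : Fin N → Finset Q} (h : IsSTPP A B C) :
    IsSTPP (fun i => (univ : Finset G).filter (fun g => q g ∈ A i)) (fun i => (B i).image s)
      (fun i => (C i).image s) := by
  intro i j k a ha a' ha' b hb b' hb' c hc c' hc' heq
  simp only [mem_filter, mem_univ, true_and] at ha ha'
  simp only [mem_image] at hb hb' hc hc'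
  obtain ⟨β, hβ, rfl⟩ := hb
  obtain ⟨β', hβ', rfl⟩ := hb'
  obtain ⟨γ, hγ, rfl⟩ := hc
  obtain ⟨γ', hγ', rfl⟩ := hc'
  have heq' : (q a' - q a) + (β' - β) + (γ' - γ) = 0 := by
    have := congrArg q heq
    simpa only [map_add, map_sub, map_zero, hs] using this
  obtain ⟨hij, hjk, -, hbb, hcc⟩ := h i j k (q a) ha (q a') ha' β hβ β' hβ' γ hγ γ' hγ' heq'
  subst hbb
  subst hcc
  have h2 : a' - a = 0 := by
    have h3 := heq
    simp only [sub_self, add_zero] at h3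
    exact h3
  exact ⟨hij, hjk, (sub_eq_zero.mp h2).symm, rfl, rfl⟩

/-- **Fibres of a surjective additive hom into a finite group have equal size**, so the preimage of a finset `S ⊆ Q` has
`|S| · |q⁻¹(0)|` elements. (Mathlib `AddMonoidHom.card_fiber_eq_of_mem_range`.) [folklore] -/
theorem card_filter_map_mem [Fintype G] [DecidableEq Q] (q : G →+ Q) (hq : Function.Surjective q) (S : Finset Q) :
    ((univ : Finset G).filter (fun g => q g ∈ S)).card =
      S.card * ((univ : Finset G).filter (fun g => q g = 0)).card := by
  rw [card_eq_sum_card_fiberwise (f := q) (s := (univ : Finset G).filter (fun g => q g ∈ S)) (t := S)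
      (fun g hg => (mem_filter.mp hg).2)]
  refine Finset.sum_const_nat fun x hx => ?_
  have hfib : ((univ : Finset G).filter (fun g => q g ∈ S)).filter (fun g => q g = x) =
      (univ : Finset G).filter (fun g => q g = x) := by
    ext g
    simp only [mem_filter, mem_univ, true_and]
    constructor
    · rintro ⟨-, hgx⟩
      exact hgx
    · intro hgx
      exact ⟨hgx ▸ hx, hgx⟩
  rw [hfib]
  exact AddMonoidHom.card_fiber_eq_of_mem_range q (Set.mem_range.mpr (hq x)) (Set.mem_range.mpr ⟨0, map_zero q⟩)

/-- **Fat-`A` lift, existential form.** Along a surjective additive hom `q : G →+ Q` (with `G` finite), an STPP family of `Q`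
with cardinalities `(|Aᵢ|, |Bᵢ|, |Cᵢ|)` yields one of `G` with cardinalities `(|Aᵢ|·|q⁻¹(0)|, |Bᵢ|, |Cᵢ|)`.
[cite: CohnKleinbergSzegedyUmans2005, Def. 5.1] -/
theorem exists_isSTPP_fatA_of_surjective [Fintype G] [DecidableEq G] [DecidableEq Q] (q : G →+ Q)
    (hq : Function.Surjective q) {A B C : Fin N → Finset Q} (h : IsSTPP A B C) :
    ∃ A' B' C' : Fin N → Finset G, IsSTPP A' B' C' ∧ ∀ i,
      (A' i).card = (A i).card * ((univ : Finset G).filter (fun g => q g = 0)).card ∧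
      (B' i).card = (B i).card ∧ (C' i).card = (C i).card := by
  have hs : ∀ x, q (Function.surjInv hq x) = x := Function.surjInv_eq hq
  have hinj : Function.Injective (Function.surjInv hq) := Function.injective_surjInv hq
  exact ⟨_, _, _, h.preimage_section q _ hs, fun i =>
    ⟨card_filter_map_mem q hq (A i), card_image_of_injective _ hinj, card_image_of_injective _ hinj⟩⟩

/-- **Fat-`B` lift** (the fat-`A` lift conjugated by the kernel role symmetry `(A,B,C) ↦ (B,C,A) ↦ back`).
[cite: CohnKleinbergSzegedyUmans2005, Def. 5.1] -/
theorem exists_isSTPP_fatB_of_surjective [Fintype G] [DecidableEq G] [DecidableEq Q] (q : G →+ Q)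
    (hq : Function.Surjective q) {A B C : Fin N → Finset Q} (h : IsSTPP A B C) :
    ∃ A' B' C' : Fin N → Finset G, IsSTPP A' B' C' ∧ ∀ i,
      (A' i).card = (A i).card ∧
      (B' i).card = (B i).card * ((univ : Finset G).filter (fun g => q g = 0)).card ∧
      (C' i).card = (C i).card := by
  obtain ⟨B', C', A', hS, hc⟩ := exists_isSTPP_fatA_of_surjective q hq (isSTPP_roles_BCA_iff.mpr h)
  exact ⟨A', B', C', isSTPP_roles_CAB hS, fun i => ⟨(hc i).2.2, (hc i).1, (hc i).2.1⟩⟩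

/-- **Fat-`C` lift** (the fat-`A` lift conjugated by the kernel role symmetry `(A,B,C) ↦ (C,A,B) ↦ back`).
[cite: CohnKleinbergSzegedyUmans2005, Def. 5.1] -/
theorem exists_isSTPP_fatC_of_surjective [Fintype G] [DecidableEq G] [DecidableEq Q] (q : G →+ Q)
    (hq : Function.Surjective q) {A B C : Fin N → Finset Q} (h : IsSTPP A B C) :
    ∃ A' B' C' : Fin N → Finset G, IsSTPP A' B' C' ∧ ∀ i,
      (A' i).card = (A i).card ∧ (B' i).card = (B i).card ∧
      (C' i).card = (C i).card * ((univ : Finset G).filter (fun g => q g = 0)).card := by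
  obtain ⟨C', A', B', hS, hc⟩ := exists_isSTPP_fatA_of_surjective q hq (isSTPP_roles_CAB h)
  exact ⟨A', B', C', isSTPP_roles_BCA_iff.mpr hS, fun i => ⟨(hc i).2.1, (hc i).2.2, (hc i).1⟩⟩

/-! ## The three census steps for an extension by a group of order 2

Below `h2 : |q⁻¹(0)| = 2`, i.e. `q` is a surjection `G → Q` whose kernel has order `2` (`|G| = 2|Q|`). -/

/-- **`TSF → T1`**: a `k`-term STPP family of SINGLETONS in `Q` (a tricolored sum-free set of size `k`,
`STPPProductFamilies.isSTPP_singleton_iff_isTricoloredSumFree`) gives the size pattern `(2,1,1)^k` in every extension `G` of `Q`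
by a group of order `2`.  Census reading: `T1(G) ≥ TSF(G/N)` for every subgroup `N ≤ G` of order `2`.
[cite: CohnKleinbergSzegedyUmans2005, Def. 5.1] -/
theorem exists_isSTPP_211_of_111_of_surjective [Fintype G] [DecidableEq G] [DecidableEq Q] (q : G →+ Q)
    (hq : Function.Surjective q) (h2 : ((univ : Finset G).filter (fun g => q g = 0)).card = 2)
    (h : ∃ A B C : Fin N → Finset Q, IsSTPP A B C ∧ ∀ i, (A i).card = 1 ∧ (B i).card = 1 ∧ (C i).card = 1) :
    ∃ A B C : Fin N → Finset G, IsSTPP A B C ∧ ∀ i, (A i).card = 2 ∧ (B i).card = 1 ∧ (C i).card = 1 := by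
  obtain ⟨A, B, C, hS, hc⟩ := h
  obtain ⟨A', B', C', hS', hc'⟩ := exists_isSTPP_fatA_of_surjective q hq hS
  refine ⟨A', B', C', hS', fun i => ?_⟩
  obtain ⟨e1, e2, e3⟩ := hc' i
  obtain ⟨f1, f2, f3⟩ := hc i
  exact ⟨by rw [e1, f1, h2], by rw [e2, f2], by rw [e3, f3]⟩

/-- **`T1 → T2`**: the size pattern `(2,1,1)^k` in `Q` gives `(1,2,2)^k` in every extension `G` of `Q` by a group of order
`2` (fatten the `C`-role to `(2,1,2)`, then rotate the roles with the kernel role symmetry).  Census reading: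
`T2(G) ≥ T1(G/N)`; e.g. `(2,1,1)⁴ ⊆ ℤ/2 × ℤ/8` forces `(1,2,2)⁴` in `ℤ/2 × ℤ/16`, `ℤ/4 × ℤ/8`, `ℤ/2 × ℤ/2 × ℤ/8`.
[cite: CohnKleinbergSzegedyUmans2005, Def. 5.1] -/
theorem exists_isSTPP_122_of_211_of_surjective [Fintype G] [DecidableEq G] [DecidableEq Q] (q : G →+ Q)
    (hq : Function.Surjective q) (h2 : ((univ : Finset G).filter (fun g => q g = 0)).card = 2)
    (h : ∃ A B C : Fin N → Finset Q, IsSTPP A B C ∧ ∀ i, (A i).card = 2 ∧ (B i).card = 1 ∧ (C i).card = 1) :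
    ∃ A B C : Fin N → Finset G, IsSTPP A B C ∧ ∀ i, (A i).card = 1 ∧ (B i).card = 2 ∧ (C i).card = 2 := by
  obtain ⟨A, B, C, hS, hc⟩ := h
  obtain ⟨A', B', C', hS', hc'⟩ := exists_isSTPP_fatC_of_surjective q hq hS
  -- `(A', B', C')` has pattern `(2,1,2)`; rotate to `(B', C', A')` with pattern `(1,2,2)`.
  refine ⟨B', C', A', isSTPP_roles_BCA_iff.mpr hS', fun i => ?_⟩
  obtain ⟨e1, e2, e3⟩ := hc' i
  obtain ⟨f1, f2, f3⟩ := hc i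
  exact ⟨by rw [e2, f2], by rw [e3, f3, h2], by rw [e1, f1]⟩

/-- **`T2 → (2,2,2)`**: the size pattern `(1,2,2)^k` in `Q` gives `k` simultaneous `⟨2,2,2⟩` triples (`(2,2,2)^k`) in every
extension `G` of `Q` by a group of order `2`.  Census reading: `n_k ≤ 2 · onset_T2(k)`, and `(2,2,2)^k ⊆ G` for every `G`
of order `2|H|` mapping onto a `T2`-host `H` (split or not).  [cite: CohnKleinbergSzegedyUmans2005, Def. 5.1] -/
theorem exists_isSTPP_222_of_122_of_surjective [Fintype G] [DecidableEq G] [DecidableEq Q] (q : G →+ Q)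
    (hq : Function.Surjective q) (h2 : ((univ : Finset G).filter (fun g => q g = 0)).card = 2)
    (h : ∃ A B C : Fin N → Finset Q, IsSTPP A B C ∧ ∀ i, (A i).card = 1 ∧ (B i).card = 2 ∧ (C i).card = 2) :
    ∃ A B C : Fin N → Finset G, IsSTPP A B C ∧ ∀ i, (A i).card = 2 ∧ (B i).card = 2 ∧ (C i).card = 2 := by
  obtain ⟨A, B, C, hS, hc⟩ := h
  obtain ⟨A', B', C', hS', hc'⟩ := exists_isSTPP_fatA_of_surjective q hq hS
  refine ⟨A', B', C', hS', fun i => ?_⟩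
  obtain ⟨e1, e2, e3⟩ := hc' i
  obtain ⟨f1, f2, f3⟩ := hc i
  exact ⟨by rw [e1, f1, h2], by rw [e2, f2], by rw [e3, f3]⟩

end Summit.MatrixMultiplication.OmegaCensus
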